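import Summits.NavierStokesRegularity.NavierStokesRegularity.Theorems.HubbleDynamoHelicityFluxIdentityBalance
import HarnessLib

/-!
# The helicity-flux identity of a Leray profile, IV: the `s`-dependent balance
# (route `HubbleDynamo`, item `HelicityFluxIdentity`, stmt-NavierStokesRegularity-2060)

Helper file (all results proved; no definitions, no named facts). The time-dependent companion of
part I (`HubbleDynamoHelicityFluxIdentityBalance`): for a classical solution of the **backward Leray
system** `∂ₛU + ½U + ½(y·∇)U + (U·∇)U + ∇P = νΔU`, `div U = 0` (the tree's
`IsBackwardLeraySolutionOn S ν U P`, Leray's `a = ½`, KNSS/Chae–Wolf normalisation; a `λ`-DSS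
blow-up is an `s`-periodic solution, a backward self-similar one an `s`-independent solution) the
helicity density `h = ⟪U, Ω⟫`, `Ω = curl U`, obeys at every similarity time `s ∈ S`

  `div F = 2ν ⟪Ω, curl Ω⟫ + ⟪∂ₛU, Ω⟫ + ⟪U, ∂ₛΩ⟫`   (`= 2ν ⟪Ω, curl Ω⟫ + ∂ₛh`),
  `F = (½|U|² − P) Ω − h (U + ½y) − ν (curl Ω) × U`

(`hubbleHelicityEvo_divergence_flux`): magnetic-helicity balance of the induction equation
`∂ₛΩ = curl((U + ½y) × Ω) + νΔΩ` (`IsBackwardLeraySolutionOn.vorticity_eq_curl_cross`) in the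
Coulomb gauge `A = U`, the helicity being destroyed only by the Ohmic term and transported by the
flux `F`; and its truncation against a compactly supported `C¹` cut-off `φ`
(`hubbleHelicityEvo_truncated`):

  `½ ∫ (y·∇φ) h = 2ν ∫ φ ⟪Ω, curl Ω⟫ + ∫ φ (⟪∂ₛU, Ω⟫ + ⟪U, ∂ₛΩ⟫) + ∫ ∇φ·((½|U|²−P)Ω)
      − ∫ ∇φ·(h U) − ν ∫ ∇φ·((curl Ω) × U)`.

The period average and the limit `R → ∞` are taken in part V.

References: as in parts I–II; Chae–Wolf, arXiv:1610.09464, §4 (the backward Leray system);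
Bradshaw–Tsai, Ann. Henri Poincaré 18 (2017) (time-periodic Leray systems).
-/

noncomputable section

-- D-0017: `<Problem> = <Summit>` by design; the lakefile turns this linter off for `Summits`.
set_option linter.dupNamespace false

open MeasureTheory Set Function Filter Topology InnerProductSpace
open scoped RealInnerProductSpace Laplacian ContDiff

namespace Summit.NavierStokesRegularity.NavierStokesRegularity.Theorems

open Literature.Analysis.FluidPDE

/-! ### The pointwise balance at a fixed similarity time -/

/-- **Helicity balance of the backward Leray system, divergence form.** For a classical solution
of `∂ₛU + ½U + ½(y·∇)U + (U·∇)U + ∇P = νΔU`, `div U = 0` on `S × ℝ³` (`S` of unique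
differentiability with `S ⊆ closure (interior S)`) and `s ∈ S`: with `Ω = curl U(s)`,
`h = ⟪U, Ω⟫`, `∂ₛU = timeDerivWithin S U s`, `∂ₛΩ = timeDerivWithin S (vorticity U) s`,

  `div ((½|U|² − P) Ω − h (U + ½y) − ν (curl Ω) × U) = 2ν ⟪Ω, curl Ω⟫ + ⟪∂ₛU, Ω⟫ + ⟪U, ∂ₛΩ⟫`.

(Leibniz rules for `div`; the vorticity equation `IsBackwardLeraySolutionOn.vorticity_eq` paired
with `U`; Leray's momentum equation paired with `Ω`; `curl curl = −Δ` on solenoidal fields.) -/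
theorem hubbleHelicityEvo_divergence_flux {S : Set ℝ} {ν : ℝ}
    {U : ℝ → EuclideanSpace ℝ (Fin 3) → EuclideanSpace ℝ (Fin 3)}
    {P : ℝ → EuclideanSpace ℝ (Fin 3) → ℝ}
    (h : IsBackwardLeraySolutionOn S ν U P) (hS : UniqueDiffOn ℝ S)
    (hcl : S ⊆ closure (interior S)) {s : ℝ} (hs : s ∈ S) (y : EuclideanSpace ℝ (Fin 3)) :
    VectorCalculus.divergence (fun z =>
        ((‖U s z‖ ^ 2 / 2 - P s z) • curl (U s) z - ⟪U s z, curl (U s) z⟫ • (U s z + (1 / 2 : ℝ) • z))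
          - ν • cross (curl (curl (U s)) z) (U s z)) y
      = 2 * ν * ⟪curl (U s) y, curl (curl (U s)) y⟫
        + ⟪timeDerivWithin S U s y, curl (U s) y⟫
        + ⟪U s y, timeDerivWithin S (vorticity U) s y⟫ := by
  -- regularity of the slices
  have hU : ContDiff ℝ ∞ (U s) := h.smooth_velocity.contDiff_slice hs
  have hP : ContDiff ℝ ∞ (P s) := h.smooth_pressure.contDiff_slice hs
  have hU3 : ContDiff ℝ 3 (U s) := hU.of_le (by norm_cast)
  have hU2 : ContDiff ℝ 2 (U s) := hU.of_le (by norm_cast)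
  have hU1 : ContDiff ℝ 1 (U s) := hU.of_le (by norm_cast)
  have hP1 : ContDiff ℝ 1 (P s) := hP.of_le (by norm_cast)
  have hΩ2 : ContDiff ℝ 2 (curl (U s)) := contDiff_curl (n := 2) (by exact_mod_cast hU3)
  have hΩ1 : ContDiff ℝ 1 (curl (U s)) := contDiff_curl (n := 1) (by exact_mod_cast hU2)
  have hΞ1 : ContDiff ℝ 1 (curl (curl (U s))) := contDiff_curl (n := 1) (by exact_mod_cast hΩ2)
  have hΩdiv : VectorCalculus.IsDivFree (curl (U s)) := fun x =>
    divergence_curl_eq_zero_holds (U s) hU2 x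
  have hdiv : VectorCalculus.IsDivFree (U s) := h.divFree s hs
  have dU : DifferentiableAt ℝ (U s) y := (hU1.differentiable one_ne_zero) y
  have dP : DifferentiableAt ℝ (P s) y := (hP1.differentiable one_ne_zero) y
  have dΩ : DifferentiableAt ℝ (curl (U s)) y := (hΩ1.differentiable one_ne_zero) y
  have dΞ : DifferentiableAt ℝ (curl (curl (U s))) y := (hΞ1.differentiable one_ne_zero) y
  have dlin : DifferentiableAt ℝ (fun z : EuclideanSpace ℝ (Fin 3) => (1 / 2 : ℝ) • z) y :=
    (hubbleDynamo_hasFDerivAt_const_smul_id (1 / 2 : ℝ) y).differentiableAt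
  have dV : DifferentiableAt ℝ (fun z => U s z + (1 / 2 : ℝ) • z) y := dU.add dlin
  have dh : DifferentiableAt ℝ (fun z => ⟪U s z, curl (U s) z⟫) y := dU.inner ℝ dΩ
  have dn : DifferentiableAt ℝ (fun z => ‖U s z‖ ^ 2 / 2) y := by
    have e : (fun z => ‖U s z‖ ^ 2 / 2) = fun z => (2⁻¹ : ℝ) * ⟪U s z, U s z⟫ := by
      funext z
      rw [real_inner_self_eq_norm_sq]
      ring
    rw [e]
    exact (dU.inner ℝ dU).const_mul _
  have dq : DifferentiableAt ℝ (fun z => ‖U s z‖ ^ 2 / 2 - P s z) y := dn.sub dP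
  have dT1 : DifferentiableAt ℝ (fun z => ⟪U s z, curl (U s) z⟫ • (U s z + (1 / 2 : ℝ) • z)) y :=
    dh.smul dV
  have dT2 : DifferentiableAt ℝ (fun z => (‖U s z‖ ^ 2 / 2 - P s z) • curl (U s) z) y :=
    dq.smul dΩ
  have dT3 : DifferentiableAt ℝ (fun z => cross (curl (curl (U s)) z) (U s z)) y :=
    (hasFDerivAt_cross dΞ.hasFDerivAt dU.hasFDerivAt).differentiableAt
  have dT21 : DifferentiableAt ℝ (fun z => (‖U s z‖ ^ 2 / 2 - P s z) • curl (U s) z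
      - ⟪U s z, curl (U s) z⟫ • (U s z + (1 / 2 : ℝ) • z)) y := dT2.sub dT1
  have dT3ν : DifferentiableAt ℝ (fun z => ν • cross (curl (curl (U s)) z) (U s z)) y :=
    dT3.const_smul ν
  -- split the divergence
  rw [divergence_sub_apply dT21 dT3ν, divergence_sub_apply dT2 dT1,
    divergence_const_smul_apply dT3, divergence_smul_apply dq dΩ, divergence_smul_apply dh dV,
    divergence_cross_holds _ _ y dΞ dU, divergence_add_apply dU dlin,
    hubbleDynamo_divergence_const_smul_id, hΩdiv y, hdiv y,
    curl_curl_eq_neg_laplacian hΩ2 hΩdiv y,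
    hubbleHelicity_inner_gradient_right, hubbleHelicity_inner_gradient_right,
    fderiv_fun_sub dn dP, fderiv_inner_apply ℝ dU dΩ]
  simp only [_root_.sub_apply, hubbleHelicity_fderiv_half_norm_sq dU, map_add, map_smul,
    inner_add_right, inner_smul_right, inner_neg_right, inner_add_left, inner_smul_left, mul_zero,
    zero_add, RCLike.conj_to_real]
  -- the vorticity equation, paired with `U`
  have hvort : timeDerivWithin S (vorticity U) s y + curl (U s) y
      + (1 / 2 : ℝ) • fderiv ℝ (curl (U s)) y y + convect (U s) (curl (U s)) y =
      convect (curl (U s)) (U s) y + ν • (Δ (curl (U s))) y := h.vorticity_eq hS hcl hs y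
  have eV := congrArg (fun v => ⟪U s y, v⟫) hvort
  -- Leray's momentum equation, paired with `Ω`
  have eP := congrArg (fun v => ⟪v, curl (U s) y⟫) (h.momentum_leray hs y)
  simp only [inner_add_right, inner_smul_right, inner_add_left, inner_smul_left, convect_apply,
    laplacian_eq_neg_curl_curl hU2 hdiv y, inner_neg_left, hubbleHelicity_inner_gradient_left,
    RCLike.conj_to_real] at eV eP
  have ec : ⟪curl (curl (U s)) y, curl (U s) y⟫ = ⟪curl (U s) y, curl (curl (U s)) y⟫ :=
    real_inner_comm _ _
  rw [ec] at eP ⊢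
  linear_combination -eV - eP


/-! ### The truncated balance at a fixed similarity time -/

/-- **Truncated `s`-dependent helicity balance.** For a classical solution of the backward Leray
system on `S × ℝ³` (`S` of unique differentiability, `S ⊆ closure (interior S)`), `s ∈ S`, and a
compactly supported `C¹` cut-off `φ`:

  `½ ∫ (y·∇φ) h = 2ν ∫ φ ⟪Ω, curl Ω⟫ + ∫ φ (⟪∂ₛU, Ω⟫ + ⟪U, ∂ₛΩ⟫) + ∫ ∇φ·((½|U|² − P) Ω)
      − ∫ ∇φ·(h U) − ν ∫ ∇φ·((curl Ω) × U)`

(`h = ⟪U, Ω⟫`; whole-space integration by parts of `hubbleHelicityEvo_divergence_flux`). -/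
theorem hubbleHelicityEvo_truncated {S : Set ℝ} {ν : ℝ}
    {U : ℝ → EuclideanSpace ℝ (Fin 3) → EuclideanSpace ℝ (Fin 3)}
    {P : ℝ → EuclideanSpace ℝ (Fin 3) → ℝ}
    (h : IsBackwardLeraySolutionOn S ν U P) (hS : UniqueDiffOn ℝ S)
    (hcl : S ⊆ closure (interior S)) {s : ℝ} (hs : s ∈ S)
    {φ : EuclideanSpace ℝ (Fin 3) → ℝ} (hφ : ContDiff ℝ 1 φ) (hφs : HasCompactSupport φ) :
    (1 / 2 : ℝ) * ∫ y, fderiv ℝ φ y y * ⟪U s y, curl (U s) y⟫ =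
      2 * ν * (∫ y, φ y * ⟪curl (U s) y, curl (curl (U s)) y⟫)
        + (∫ y, φ y * (⟪timeDerivWithin S U s y, curl (U s) y⟫
            + ⟪U s y, timeDerivWithin S (vorticity U) s y⟫))
        + (∫ y, fderiv ℝ φ y ((‖U s y‖ ^ 2 / 2 - P s y) • curl (U s) y))
        - (∫ y, fderiv ℝ φ y (⟪U s y, curl (U s) y⟫ • U s y))
        - ν * ∫ y, fderiv ℝ φ y (cross (curl (curl (U s)) y) (U s y)) := by
  -- regularity of the slices
  have hU : ContDiff ℝ ∞ (U s) := h.smooth_velocity.contDiff_slice hs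
  have hP : ContDiff ℝ ∞ (P s) := h.smooth_pressure.contDiff_slice hs
  have hU3 : ContDiff ℝ 3 (U s) := hU.of_le (by norm_cast)
  have hU2 : ContDiff ℝ 2 (U s) := hU.of_le (by norm_cast)
  have hU1 : ContDiff ℝ 1 (U s) := hU.of_le (by norm_cast)
  have hP1 : ContDiff ℝ 1 (P s) := hP.of_le (by norm_cast)
  have hΩ2 : ContDiff ℝ 2 (curl (U s)) := contDiff_curl (n := 2) (by exact_mod_cast hU3)
  have hΩ1 : ContDiff ℝ 1 (curl (U s)) := contDiff_curl (n := 1) (by exact_mod_cast hU2)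
  have hΞ1 : ContDiff ℝ 1 (curl (curl (U s))) := contDiff_curl (n := 1) (by exact_mod_cast hΩ2)
  have hdU : ContDiff ℝ ∞ (timeDerivWithin S U s) :=
    (h.smooth_velocity.timeDerivWithin hS).contDiff_slice hs
  have hdΩ : ContDiff ℝ ∞ (timeDerivWithin S (vorticity U) s) :=
    ((h.smooth_velocity.isSmoothSpaceTimeOn_vorticity hS).timeDerivWithin hS).contDiff_slice hs
  have cU : Continuous (U s) := hU1.continuous
  have cP : Continuous (P s) := hP1.continuous
  have cΩ : Continuous (curl (U s)) := hΩ1.continuous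
  have cΞ : Continuous (curl (curl (U s))) := hΞ1.continuous
  have ch : Continuous (fun z => ⟪U s z, curl (U s) z⟫) := cU.inner cΩ
  have cq : Continuous (fun z => ‖U s z‖ ^ 2 / 2 - P s z) := ((cU.norm.pow 2).div_const 2).sub cP
  have cT : Continuous (fun z => ⟪timeDerivWithin S U s z, curl (U s) z⟫
      + ⟪U s z, timeDerivWithin S (vorticity U) s z⟫) :=
    (hdU.continuous.inner cΩ).add (cU.inner hdΩ.continuous)
  -- integration by parts against `φ`
  have hF := hubbleHelicity_contDiff_flux (ν := ν) (a := (1 / 2 : ℝ)) hU3 hP1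
  have ibp := integral_mul_divergence_add_eq_zero_left hφ hF hφs
  -- the integrands
  have i0 : Integrable (fun y => φ y * ⟪curl (U s) y, curl (curl (U s)) y⟫) :=
    (hφ.continuous.mul (cΩ.inner cΞ)).integrable_of_hasCompactSupport hφs.mul_right
  have iT : Integrable (fun y => φ y * (⟪timeDerivWithin S U s y, curl (U s) y⟫
      + ⟪U s y, timeDerivWithin S (vorticity U) s y⟫)) :=
    (hφ.continuous.mul cT).integrable_of_hasCompactSupport hφs.mul_right
  have i1 : Integrable (fun y => fderiv ℝ φ y ((‖U s y‖ ^ 2 / 2 - P s y) • curl (U s) y)) :=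
    hubbleHelicity_integrable_fderiv_apply hφ hφs (cq.smul cΩ)
  have i2 : Integrable (fun y => fderiv ℝ φ y (⟪U s y, curl (U s) y⟫ • U s y)) :=
    hubbleHelicity_integrable_fderiv_apply hφ hφs (ch.smul cU)
  have i3 : Integrable (fun y => fderiv ℝ φ y y * ⟪U s y, curl (U s) y⟫) := by
    have := hubbleHelicity_integrable_fderiv_apply hφ hφs
      (G := fun y => ⟪U s y, curl (U s) y⟫ • y) (ch.smul continuous_id)
    refine this.congr (Eventually.of_forall fun y => ?_)
    simp only [map_smul, smul_eq_mul]
    ring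
  have i4 : Integrable (fun y => fderiv ℝ φ y (cross (curl (curl (U s)) y) (U s y))) :=
    hubbleHelicity_integrable_fderiv_apply hφ hφs
      ((hubbleHelicity_contDiff_cross hΞ1 hU1).continuous)
  -- rewrite both integrals of the integration-by-parts identity
  have e1 : ∫ y, φ y * VectorCalculus.divergence (fun z =>
        ((‖U s z‖ ^ 2 / 2 - P s z) • curl (U s) z
          - ⟪U s z, curl (U s) z⟫ • (U s z + (1 / 2 : ℝ) • z))
          - ν • cross (curl (curl (U s)) z) (U s z)) y
      = 2 * ν * (∫ y, φ y * ⟪curl (U s) y, curl (curl (U s)) y⟫)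
        + ∫ y, φ y * (⟪timeDerivWithin S U s y, curl (U s) y⟫
            + ⟪U s y, timeDerivWithin S (vorticity U) s y⟫) := by
    rw [← integral_const_mul, ← integral_add (i0.const_mul _) iT]
    refine integral_congr_ae (Eventually.of_forall fun y => ?_)
    simp only [hubbleHelicityEvo_divergence_flux h hS hcl hs y]
    ring
  have e2 : ∫ y, ⟪((‖U s y‖ ^ 2 / 2 - P s y) • curl (U s) y
          - ⟪U s y, curl (U s) y⟫ • (U s y + (1 / 2 : ℝ) • y))
          - ν • cross (curl (curl (U s)) y) (U s y), gradient φ y⟫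
      = ∫ y, (((fderiv ℝ φ y ((‖U s y‖ ^ 2 / 2 - P s y) • curl (U s) y)
          - fderiv ℝ φ y (⟪U s y, curl (U s) y⟫ • U s y))
          - (1 / 2 : ℝ) * (fderiv ℝ φ y y * ⟪U s y, curl (U s) y⟫))
          - ν * fderiv ℝ φ y (cross (curl (curl (U s)) y) (U s y))) := by
    refine integral_congr_ae (Eventually.of_forall fun y => ?_)
    simp only [hubbleHelicity_inner_gradient_right, map_sub, map_add, map_smul, smul_eq_mul]
    ring
  rw [integral_sub ((i1.sub' i2).sub' (i3.const_mul (1 / 2 : ℝ))) (i4.const_mul ν),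
    integral_sub (i1.sub' i2) (i3.const_mul (1 / 2 : ℝ)), integral_sub i1 i2, integral_const_mul,
    integral_const_mul] at e2
  rw [e1, e2] at ibp
  linear_combination -ibp


/-! ### Time integration of the `∂ₛ`-term -/

/-- **The `∂ₛ`-term integrates to a boundary term in time.** For a classical solution of the
backward Leray system on all of `ℝ × ℝ³`, a continuous compactly supported weight `φ` and `s ≤ t`:
`∫ₛᵗ ∫ φ (⟪∂ₛU, Ω⟫ + ⟪U, ∂ₛΩ⟫) dy dτ = ∫ φ ⟪U(t), Ω(t)⟫ − ∫ φ ⟪U(s), Ω(s)⟫` (Fubini over the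
compact `y`-support, the integrand being jointly continuous, and the fundamental theorem of
calculus on each time line; the pattern of the tree's
`IsSmoothSpaceTimeOn.integral_Ioo_integral_mul_inner_timeDerivWithin`). For an `s`-periodic
solution and `t = s + period` the right-hand side vanishes. -/
theorem hubbleHelicityEvo_integral_Ioo_timeDeriv {ν : ℝ}
    {U : ℝ → EuclideanSpace ℝ (Fin 3) → EuclideanSpace ℝ (Fin 3)}
    {P : ℝ → EuclideanSpace ℝ (Fin 3) → ℝ} (h : IsBackwardLeraySolutionOn univ ν U P)
    {φ : EuclideanSpace ℝ (Fin 3) → ℝ} (hφ : Continuous φ) (hc : HasCompactSupport φ)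
    {s t : ℝ} (hst : s ≤ t) :
    ∫ τ in Ioo s t, ∫ y, φ y * (⟪timeDerivWithin univ U τ y, curl (U τ) y⟫
        + ⟪U τ y, timeDerivWithin univ (vorticity U) τ y⟫) =
      (∫ y, φ y * ⟪U t y, curl (U t) y⟫) - ∫ y, φ y * ⟪U s y, curl (U s) y⟫ := by
  have hSu : UniqueDiffOn ℝ (univ : Set ℝ) := uniqueDiffOn_univ
  have hw : IsSmoothSpaceTimeOn univ U := h.smooth_velocity
  have hΩ : IsSmoothSpaceTimeOn univ (vorticity U) := hw.isSmoothSpaceTimeOn_vorticity hSu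
  have cU : ContinuousOn (uncurry U) (univ ×ˢ univ) := hw.continuousOn
  have cΩ : ContinuousOn (uncurry (vorticity U)) (univ ×ˢ univ) := hΩ.continuousOn
  have cdU : ContinuousOn (uncurry (timeDerivWithin univ U)) (univ ×ˢ univ) :=
    (hw.timeDerivWithin hSu).continuousOn
  have cdΩ : ContinuousOn (uncurry (timeDerivWithin univ (vorticity U))) (univ ×ˢ univ) :=
    (hΩ.timeDerivWithin hSu).continuousOn
  have hKφ : ∀ x ∉ tsupport φ, φ x = 0 := fun x hx => image_eq_zero_of_notMem_tsupport hx
  set D : ℝ × EuclideanSpace ℝ (Fin 3) → ℝ := fun z =>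
    φ z.2 * (⟪timeDerivWithin univ U z.1 z.2, vorticity U z.1 z.2⟫
      + ⟪U z.1 z.2, timeDerivWithin univ (vorticity U) z.1 z.2⟫) with hD
  have hsub : Icc s t ×ˢ (univ : Set (EuclideanSpace ℝ (Fin 3))) ⊆ univ ×ˢ univ :=
    prod_mono (subset_univ _) Subset.rfl
  have hDcont : ContinuousOn D (Icc s t ×ˢ univ) :=
    (hφ.comp continuous_snd).continuousOn.mul
      (((cdU.mono hsub).inner (cΩ.mono hsub)).add ((cU.mono hsub).inner (cdΩ.mono hsub)))
  have hDK : ∀ τ ∈ Icc s t, ∀ x ∉ tsupport φ, D (τ, x) = 0 := fun τ _ x hx => by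
    simp [hD, hKφ x hx]
  have hDint := integrable_prod_of_continuousOn hc hDcont hDK
  have hswap := integral_integral_swap (f := fun τ x => D (τ, x)) hDint
  simp only [hD] at hswap
  change ∫ τ in Ioo s t, ∫ y, φ y * (⟪timeDerivWithin univ U τ y, vorticity U τ y⟫
      + ⟪U τ y, timeDerivWithin univ (vorticity U) τ y⟫) =
    (∫ y, φ y * ⟪U t y, vorticity U t y⟫) - ∫ y, φ y * ⟪U s y, vorticity U s y⟫
  rw [hswap]
  have hslice : ∀ r : ℝ, Integrable (fun x => φ x * ⟪U r x, vorticity U r x⟫)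
      (volume : Measure (EuclideanSpace ℝ (Fin 3))) := fun r =>
    (hφ.mul ((hw.contDiff_slice (mem_univ r)).continuous.inner
      (hΩ.contDiff_slice (mem_univ r)).continuous)).integrable_of_hasCompactSupport hc.mul_right
  have hline : ∀ x, ∫ τ in Ioo s t, φ x * (⟪timeDerivWithin univ U τ x, vorticity U τ x⟫
      + ⟪U τ x, timeDerivWithin univ (vorticity U) τ x⟫) =
      φ x * ⟪U t x, vorticity U t x⟫ - φ x * ⟪U s x, vorticity U s x⟫ := by
    intro x
    have hderiv : ∀ τ ∈ uIcc s t, HasDerivAt (fun σ => φ x * ⟪U σ x, vorticity U σ x⟫)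
        (φ x * (⟪timeDerivWithin univ U τ x, vorticity U τ x⟫
          + ⟪U τ x, timeDerivWithin univ (vorticity U) τ x⟫)) τ := by
      intro τ _
      have hu' : HasDerivAt (fun σ => U σ x) (timeDerivWithin univ U τ x) τ :=
        (hw.hasDerivWithinAt_timeDerivWithin hSu (mem_univ τ) x).hasDerivAt univ_mem
      have hΩ' : HasDerivAt (fun σ => vorticity U σ x) (timeDerivWithin univ (vorticity U) τ x) τ :=
        (hΩ.hasDerivWithinAt_timeDerivWithin hSu (mem_univ τ) x).hasDerivAt univ_mem
      refine ((hu'.inner ℝ hΩ').const_mul (φ x)).congr_deriv ?_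
      ring
    have hint : IntervalIntegrable (fun τ => φ x * (⟪timeDerivWithin univ U τ x, vorticity U τ x⟫
        + ⟪U τ x, timeDerivWithin univ (vorticity U) τ x⟫)) volume s t := by
      refine ContinuousOn.intervalIntegrable ?_
      rw [uIcc_of_le hst]
      exact hDcont.comp (Continuous.prodMk_left x).continuousOn
        fun τ hτ => mk_mem_prod hτ (mem_univ x)
    have := intervalIntegral.integral_eq_sub_of_hasDerivAt hderiv hint
    rw [intervalIntegral.integral_of_le hst, integral_Ioc_eq_integral_Ioo] at this
    rw [this]
  rw [integral_congr_ae (Eventually.of_forall hline), integral_sub (hslice t) (hslice s)]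

end Summit.NavierStokesRegularity.NavierStokesRegularity.Theorems

end
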